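import Summits.QuantumFields.YangMills.Theorems.LuscherReductionDressedRitzPolyakovLiftTransplantPositivity
import Summits.QuantumFields.YangMills.Theorems.LuscherReductionDressedRitzPolyakovLiftStaticsOfSeparation
import Summits.QuantumFields.YangMills.Theorems.LuscherReductionDressedRitzPolyakovLiftBasisGenericL
import HarnessLib

/-!
# Line «polyakovlift» r6 on crux `DressedRitz` (stmt-QuantumFields-20205): S-STAT″ for SEPARATED root-transplant bases (both clauses, `C = 0`)

Fleet-service module of seat ym-infvol-p1 g7 (holder of S-STAT `stub_liftStatics`, r6 `09c950a55cd7b1f3`: `∀ k, StaticsForL (TransplantBasisL k)`).  The r5 capstone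
`staticClauses_of_pairSeparated` (p545957) derived BOTH static clauses for a lift basis all of whose pairs are `PairSeparated` — (o0) from the exact one-site
eigen-equation (`dressedLiftFamily_o0`), (o2) exactly (`= 0`) from the lift symmetries.  For the registered r6 bases the (o0) input is now the seat's
`dressedLiftFamily_o0_transplantL` (p560815; no eigen-equation for `g_i`, instead `12·physLevel(k+1)·Λ < 1`), and (o2) is basis-agnostic.  Hence:

* ★ `staticClauses_of_pairSeparated_phys` — ANY family of physical one-site channels with (o0) and pairwise `PairSeparated` members satisfies `StaticClauses k C β`
  for every `C ≥ 0` (the basis predicate is irrelevant to (o2));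
* ★★ `staticClauses_transplantL_of_pairSeparated` — for a `TransplantBasisL k L Λ g` basis with pairwise separated members, `β ≥ 1`, `12·physLevel(k+1)·Λ < 1`:
  `StaticClauses k C β (dressedLiftFamily β φ g)` for every `C ≥ 0` and every raw vacuum;
* ★★ `staticsForL_level_of_separated` — the registered level-`k` text `StaticsForL (TransplantBasisL k)` RESTRICTED to separated bases, with `C = 0`,
  `lam0 = 1/(24·physLevel(k+1)+24)`, `L0 = 0`: the form in which an AL1 isotype-separation certificate (next files: chart equivariance of `rootCoord` under the
  hyperoctahedral lift symmetries, parity of the AL1 eigenfunctions) discharges S-STAT″ below the first repeated `O_h`-isotype;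
* `coreO6_transplantL_of_pairSeparated` — the coupling clause (o6) likewise (exact zero).

HONEST FRAMING: packaging on the conditional femto rung R2b1; the separation certificate for concrete AL1 families is NOT supplied here (open ONE-type
classification of the low levels of `𝔥`); the RG content of S-STAT″ above the first repeated isotype is untouched; not infinite volume, not a gap, not Clay.
References: M. Lüscher, NPB 219 (1983) 233 [cite: Luscher1983, §3]; M. Lüscher, U. Wolff, NPB 339 (1990) 222 [cite: LuscherWolff1990];
M. Lüscher, G. Münster, NPB 232 (1984) 445 [cite: LuscherMunster1984, §4].
-/

set_option autoImplicit false

noncomputable section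

open MeasureTheory Filter Topology Real
open Literature.MathematicalPhysics.QuantumFieldTheory (GaugeConfig Site gaugeTransform)
open Literature.Analysis.OperatorTheory.YMMatrixModel
open scoped BigOperators

namespace Summit.QuantumFields.YangMills.Theorems.FemtoTransferGap.PolyakovLift

open Summit.QuantumFields.YangMills.Theorems.FemtoTransferGap

variable {L : ℕ} [NeZero L]

/-- ★ **Static clauses for ANY physical family with (o0) and pairwise separated members**, every `C ≥ 0` ((o2) is exact). [cite: Luscher1983, §3] [cite: LuscherWolff1990] -/
theorem staticClauses_of_pairSeparated_phys (β : ℝ) {φ : GaugeConfig 3 L SU2 → ℝ} (hvac : IsRawVacuum β φ) {k : ℕ}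
    {g : Fin k → (Cfg → ℝ)} (hg : ∀ i, IsPhys (g i)) (ho0 : ∀ i, 0 < l2 (dressedLiftFamily β φ g i) (dressedLiftFamily β φ g i))
    (hsep : ∀ i l : Fin k, i ≠ l → PairSeparated (g i) (g l)) {C : ℝ} (hC : 0 ≤ C) :
    StaticClauses k C β (dressedLiftFamily β φ g) := by
  refine ⟨ho0, fun i l hil => ?_⟩
  have h0 : l2 (dressedLiftFamily β φ g i) (dressedLiftFamily β φ g l) = 0 :=
    (dressed_pair_eq_zero_of_pairSeparated β hvac (hg i) (hg l) (hsep i l hil)).1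
  rw [h0, abs_zero]
  exact mul_nonneg (mul_nonneg hC (KTRCalibration.luscherLambda_nonneg β L)) (mul_nonneg (Real.sqrt_nonneg _) (Real.sqrt_nonneg _))

/-- ★★ **Static clauses for a separated root-transplant basis** (`TransplantBasisL`, r6): `β ≥ 1`, `Λ > 0` with `12·physLevel(k+1)·Λ < 1`, any raw vacuum,
every `C ≥ 0`. [cite: Luscher1983, §3] [cite: LuscherWolff1990] -/
theorem staticClauses_transplantL_of_pairSeparated {β : ℝ} (hβ : 1 ≤ β) {φ : GaugeConfig 3 L SU2 → ℝ} (hvac : IsRawVacuum β φ)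
    {k : ℕ} {Λ : ℝ} (hΛ : 0 < Λ) (hΛk : 12 * physLevel (k + 1) * Λ < 1) {g : Fin k → (Cfg → ℝ)} (hbasis : TransplantBasisL k L Λ g)
    (hsep : ∀ i l : Fin k, i ≠ l → PairSeparated (g i) (g l)) {C : ℝ} (hC : 0 ≤ C) :
    StaticClauses k C β (dressedLiftFamily β φ g) :=
  staticClauses_of_pairSeparated_phys β hvac (basisPhysL_transplantBasisL k L Λ g hbasis)
    (dressedLiftFamily_o0_transplantL hβ hvac hΛ hΛk hbasis) hsep hC

/-- ★★ **The registered level-`k` text of S-STAT″ restricted to SEPARATED bases, with `C = 0`** (`lam0 = 1/(24·physLevel(k+1)+24)`, `L0 = 0`): for every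
`0 < lam ≤ lam0`, every fine lattice, every `β` in the femto window, every raw vacuum and every `TransplantBasisL k L (luscherLambda β L) g` basis whose members are
pairwise `PairSeparated`, `StaticClauses k 0 β (dressedLiftFamily β φ g)`. [cite: Luscher1983, §3] [cite: LuscherWolff1990] -/
theorem staticsForL_level_of_separated (k : ℕ) : ∃ lam0 : ℝ, 0 < lam0 ∧ ∀ lam : ℝ, 0 < lam → lam ≤ lam0 →
    ∀ (L : ℕ) [NeZero L] (β : ℝ), InFemtoWindow lam β L → ∀ φ : GaugeConfig 3 L SU2 → ℝ, IsRawVacuum β φ →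
      ∀ g : Fin k → (Cfg → ℝ), TransplantBasisL k L (luscherLambda β L) g → (∀ i l : Fin k, i ≠ l → PairSeparated (g i) (g l)) →
        StaticClauses k 0 β (dressedLiftFamily β φ g) := by
  obtain ⟨lam0, hlam0, h⟩ := o0_level_transplantL k
  refine ⟨lam0, hlam0, fun lam hlam hle L _ β hW φ hvac g hbasis hsep => ?_⟩
  exact staticClauses_of_pairSeparated_phys β hvac (basisPhysL_transplantBasisL k L _ g hbasis)
    (h lam hlam hle L β hW φ hvac g hbasis) hsep le_rfl

/-- The coupling clause (o6) of `DynamicCoreClauses` for a separated pair of a root-transplant basis, with ANY `C ≥ 0` (exact zero).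
[cite: Luscher1983, §3] [cite: LuscherWolff1990] -/
theorem coreO6_transplantL_of_pairSeparated (β : ℝ) {φ : GaugeConfig 3 L SU2 → ℝ} (hvac : IsRawVacuum β φ)
    {k : ℕ} {Λ : ℝ} {g : Fin k → (Cfg → ℝ)} (hbasis : TransplantBasisL k L Λ g)
    {C : ℝ} (hC : 0 ≤ C) (i l : Fin k) (hsep : PairSeparated (g i) (g l)) :
    |l2 (dressedLiftFamily β φ g i) (transferApply β (dressedLiftFamily β φ g l)) -
        (l2 (dressedLiftFamily β φ g i) (transferApply β (dressedLiftFamily β φ g i)) /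
              l2 (dressedLiftFamily β φ g i) (dressedLiftFamily β φ g i) +
            l2 (dressedLiftFamily β φ g l) (transferApply β (dressedLiftFamily β φ g l)) /
              l2 (dressedLiftFamily β φ g l) (dressedLiftFamily β φ g l)) / 2 *
          l2 (dressedLiftFamily β φ g i) (dressedLiftFamily β φ g l)|
      ≤ C * (luscherLambda β L ^ 2 / L) * levelValue su2Rep L β 0 *
          (Real.sqrt (l2 (dressedLiftFamily β φ g i) (dressedLiftFamily β φ g i)) *
            Real.sqrt (l2 (dressedLiftFamily β φ g l) (dressedLiftFamily β φ g l))) := by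
  have hg : ∀ j, IsPhys (g j) := basisPhysL_transplantBasisL k L Λ g hbasis
  obtain ⟨h0, h1⟩ := dressed_pair_eq_zero_of_pairSeparated β hvac (hg i) (hg l) hsep
  have h0' : l2 (dressedLiftFamily β φ g i) (dressedLiftFamily β φ g l) = 0 := h0
  have h1' : l2 (dressedLiftFamily β φ g i) (transferApply β (dressedLiftFamily β φ g l)) = 0 := h1
  rw [h1', h0', mul_zero, sub_zero, abs_zero]
  have hl0 : 0 ≤ levelValue su2Rep L β 0 := by rw [levelValue_zero]; exact topValue_nonneg su2Rep L β
  exact mul_nonneg (mul_nonneg (mul_nonneg hC (div_nonneg (sq_nonneg _) (Nat.cast_nonneg _))) hl0)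
    (mul_nonneg (Real.sqrt_nonneg _) (Real.sqrt_nonneg _))

end Summit.QuantumFields.YangMills.Theorems.FemtoTransferGap.PolyakovLift

end
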